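import Mathlib
import Summits.NavierStokesRegularity.FluidComputer.GalerkinFluxCeiling
import HarnessLib

/-!
# Transfer across a spectral GAP in the exact Galerkin system is pure straining:
# `dE_O/dt ≤ 2(σ_I − νK_O²)·E_O + √(2E_O)·Φ_O` — the Obukhov–Palasek inequality as a kernel upper bound

HONEST FRAMING (cell `ns-blowup`, seat `ns-blowup-circuit` g5, human ruling D-0035): nothing here is
a claim about Navier–Stokes blow-up. WHAT THIS IS NOT: not NS; finite exact-coefficient Galerkin
systems `IsGalerkinSolution U (I ∪ O) ν c f` only (part 3 of `GalerkinFluxCeiling*`, p437361 /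
p438574).

## What is typed (memo `CIRCUIT-OBSTRUCTIONS.md` §H «sideband / straining triads», §I, §L)

When the support `S = I ∪ O` has a SPECTRAL GAP — no inside mode is the difference of an outside
and an inside mode (`k - p ∉ I` for `k ∈ O`, `p ∈ I`; e.g. `|p| ≤ K_I` on `I` and `|k| > 2K_I` on
`O`, `gap_of_norms`) — every triad coupling the two bands has ONE leg inside and TWO outside
(nonlocal "straining / sweeping" triads). Then the mediator of every `I → O` transfer is itself an
outside mode, and the flux ceiling of part 1 sharpens from `σ_I·√(2E_O)·√(2E_S)` to

* `abs_shellTransfer_le_gap` — **`|Π(I→O)| ≤ σ_I · 2E_O`**, `σ_I = Σ_{p∈I}|p||û(p)|` the inside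
  ℓ¹-strain: across a gap the exact nonlinearity can only AMPLIFY what the outside band already
  holds, at rate at most the inside strain — there is no deposit term;
* `outsideBudget_le_gap` — the right side of Frisch's outside budget (`= dE_O/dt` along the Galerkin flow,
  outside modes `|k|² ≥ K2`) obeys `≤ 2(σ_I − ν·K2)·E_O + √(2E_O)·Φ_O` with `Φ_O` the outside force amplitude —
  the Obukhov / Palasek level inequality `ẋ_k ≤ (A_{k-1} − νN_k²)x_k + g_k` [Palasek arXiv:2605.13827
  §3] as an UPPER BOUND obeyed by every exact-coefficient gapped tower, with the pump `A_{k-1}`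
  replaced by the rigorous inside strain `σ_{<k}` (`≤` its Bernstein value `K_I√(#I)√(2E_I)`,
  `lowStrain_le_sqrt_card`, i.e. Palasek's `α = 5/2`);
* `outsideEnergy_antitoneOn_of_gap` — unforced: if `σ_I(t) ≤ ν·K2` on `[0,T)` the outside energy
  is NON-INCREASING on `[0,T]` (no growth at all across the gap, whatever `E_O(0)` is);
* `gap_of_norms` — the norm condition `|p| ≤ K_I` (`p ∈ I`), `2K_I < |k|` (`k ∈ O`) implies the gap.

READING for the cell's rate table: a super-lacunary exact-coefficient tower (levels around `N_k`,
`N_{k+1} ≥ N_k^b`, any thickness up to a fixed factor) is dominated level by level by Palasek's ODE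
inequalities with `A_{k-1} ≤ C N_{k-1}^{5/2} √E`; growth of level `k` needs `σ_{<k} > νN_k²`, i.e.
`N_{k-1}^{5/2}√E ≳ νN_{k-1}^{2b}` — impossible for large `k` when `b > 5/4`, marginal at `b = 5/4`,
and for `1 < b < 5/4` possible only with inside coherence within a factor `N^{-(5/2-2b)}` of full
Bernstein saturation (Palasek's `α > 2b`). All proved, 0 sorry, no definitions.
-/

noncomputable section

namespace Summit.NavierStokesRegularity.FluidComputer.GalerkinFluxCeiling

open Set Finset Literature.Analysis.FluidPDE.FluidComputer
  Literature.Analysis.FluidPDE.FluidComputer.ShellTransfer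
  Summit.NavierStokesRegularity.FluidComputer.SparseGalerkinCeiling
open scoped ComplexConjugate

/-- `Σ f g ≤ √(Σ f²) · √(Σ g²)`. -/
private theorem sum_mul_le_sqrt_mul_sqrt' {ι : Type*} (s : Finset ι) (f g : ι → ℝ) :
    ∑ i ∈ s, f i * g i ≤ Real.sqrt (∑ i ∈ s, f i ^ 2) * Real.sqrt (∑ i ∈ s, g i ^ 2) := by
  rw [← Real.sqrt_mul (Finset.sum_nonneg fun i _ => sq_nonneg (f i))]
  exact (le_abs_self _).trans (Real.abs_le_sqrt (Finset.sum_mul_sq_le_sq_mul_sq s f g))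

/-! ## §1 The gap and the shifted energy -/

/-- **A norm gap implies a spectral gap**: if every inside mode has `|p| ≤ K_I` and every outside
mode has `|k| > 2K_I`, then `k - p ∉ I` for `k ∈ O`, `p ∈ I` (triangle inequality: `|k - p| ≥
|k| - |p| > K_I`). -/
theorem gap_of_norms {I O : Finset (Fin 3 → ℤ)} {KI : ℝ}
    (hI : ∀ p ∈ I, Real.sqrt (knormSq p) ≤ KI) (hO : ∀ k ∈ O, 2 * KI < Real.sqrt (knormSq k)) :
    ∀ k ∈ O, ∀ p ∈ I, k - p ∉ I := by
  intro k hk p hp hmem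
  have h1 := hI (k - p) hmem
  have h2 := hI p hp
  have h3 := hO k hk
  have htri := sqrt_knormSq_add_le (k - p) p
  rw [sub_add_cancel] at htri
  linarith

/-- Shifted outside energy across a gap: for a field vanishing off `I ∪ O` and `p` with
`k - p ∉ I` for all `k ∈ O`, `Σ_{k∈O} |û(k-p)|² ≤ 2·E_O` — the mediators are outside modes. -/
theorem sum_shift_modalEnergy_le_of_gap (U : FourierVelocity) (I O : Finset (Fin 3 → ℤ))
    (p : Fin 3 → ℤ) (hoff : ∀ q ∉ I ∪ O, U.coeff q = 0) (hgap : ∀ k ∈ O, k - p ∉ I) :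
    ∑ k ∈ O, 2 * modalEnergy U (k - p) ≤ 2 * truncEnergy U O := by
  classical
  have hinj : Set.InjOn (fun k : Fin 3 → ℤ => k - p) ↑O := fun a _ b _ h => sub_left_injective h
  rw [show ∑ k ∈ O, 2 * modalEnergy U (k - p) = ∑ q ∈ O.image (fun k => k - p), 2 * modalEnergy U q
    from (Finset.sum_image (f := fun q => 2 * modalEnergy U q) hinj).symm]
  unfold truncEnergy
  rw [Finset.mul_sum, ← Finset.sum_filter_add_sum_filter_not (O.image fun k => k - p) (fun q => q ∈ O)]
  have hzero : ∑ q ∈ (O.image fun k => k - p).filter (fun q => ¬ q ∈ O), 2 * modalEnergy U q = 0 := by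
    refine Finset.sum_eq_zero fun q hq => ?_
    obtain ⟨hq1, hq2⟩ := Finset.mem_filter.mp hq
    obtain ⟨k, hk, rfl⟩ := Finset.mem_image.mp hq1
    have hnot : k - p ∉ I ∪ O := by
      rw [Finset.mem_union, not_or]; exact ⟨hgap k hk, hq2⟩
    rw [modalEnergy_eq_zero_of_coeff U (hoff _ hnot), mul_zero]
  rw [hzero, add_zero]
  refine Finset.sum_le_sum_of_subset_of_nonneg (fun q hq => (Finset.mem_filter.mp hq).2) ?_
  intro q _ _
  have := modalEnergy_nonneg U q
  positivity

/-! ## §2 The gap flux lemma -/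

/-- **GAP FLUX LEMMA.** For a field vanishing off `I ∪ O` with a spectral gap (`k - p ∉ I` for
`k ∈ O`, `p ∈ I`): `|shellTransfer û O I| ≤ σ_I · (2·E_O)`, `σ_I = Σ_{p∈I}|p||û(p)|`. Across a gap
the transfer is LINEAR in the outside energy with rate at most the inside ℓ¹-strain — pure
straining/sweeping, no deposit. -/
theorem abs_shellTransfer_le_gap (U : FourierVelocity) (I O : Finset (Fin 3 → ℤ))
    (hoff : ∀ q ∉ I ∪ O, U.coeff q = 0) (hgap : ∀ k ∈ O, ∀ p ∈ I, k - p ∉ I) :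
    |shellTransfer U O I| ≤
      (∑ p ∈ I, Real.sqrt (knormSq p) * Real.sqrt (2 * modalEnergy U p)) * (2 * truncEnergy U O) := by
  unfold shellTransfer
  rw [Finset.sum_comm]
  refine (Finset.abs_sum_le_sum_abs _ _).trans ?_
  rw [Finset.sum_mul]
  refine Finset.sum_le_sum fun p hp => ?_
  refine (Finset.abs_sum_le_sum_abs _ _).trans ?_
  have hk : ∀ k ∈ O, |modeTransfer U k p| ≤ Real.sqrt (knormSq p) * Real.sqrt (2 * modalEnergy U p) *
      (Real.sqrt (2 * modalEnergy U k) * Real.sqrt (2 * modalEnergy U (k - p))) := by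
    intro k _
    calc |modeTransfer U k p| ≤ Real.sqrt (knormSq p) * Real.sqrt (2 * modalEnergy U (k - p)) *
          (Real.sqrt (2 * modalEnergy U k) * Real.sqrt (2 * modalEnergy U p)) :=
          abs_modeTransfer_le_giver U k p
      _ = _ := by ring
  refine (Finset.sum_le_sum hk).trans ?_
  rw [← Finset.mul_sum]
  refine mul_le_mul_of_nonneg_left ?_ (by positivity)
  refine (sum_mul_le_sqrt_mul_sqrt' O _ _).trans ?_
  have h1 : ∑ k ∈ O, Real.sqrt (2 * modalEnergy U k) ^ 2 = 2 * truncEnergy U O := by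
    unfold truncEnergy
    rw [Finset.mul_sum]
    refine Finset.sum_congr rfl fun k _ => Real.sq_sqrt ?_
    have := modalEnergy_nonneg U k; positivity
  have h2 : ∑ k ∈ O, Real.sqrt (2 * modalEnergy U (k - p)) ^ 2 ≤ 2 * truncEnergy U O := by
    calc ∑ k ∈ O, Real.sqrt (2 * modalEnergy U (k - p)) ^ 2 = ∑ k ∈ O, 2 * modalEnergy U (k - p) :=
          Finset.sum_congr rfl fun k _ => Real.sq_sqrt (by have := modalEnergy_nonneg U (k - p); positivity)
      _ ≤ 2 * truncEnergy U O := sum_shift_modalEnergy_le_of_gap U I O p hoff (fun k hk => hgap k hk p hp)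
  have hEO : 0 ≤ 2 * truncEnergy U O := by
    have := Finset.sum_nonneg fun k (_ : k ∈ O) => modalEnergy_nonneg U k
    unfold truncEnergy; positivity
  rw [h1]
  calc Real.sqrt (2 * truncEnergy U O) * Real.sqrt (∑ k ∈ O, Real.sqrt (2 * modalEnergy U (k - p)) ^ 2)
      ≤ Real.sqrt (2 * truncEnergy U O) * Real.sqrt (2 * truncEnergy U O) :=
        mul_le_mul_of_nonneg_left (Real.sqrt_le_sqrt h2) (Real.sqrt_nonneg _)
    _ = 2 * truncEnergy U O := Real.mul_self_sqrt hEO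

/-! ## §3 Along the Galerkin flow: the Obukhov–Palasek inequality as an upper bound -/

/-- **The right-hand side of Frisch's outside budget across a gap is bounded by straining:**
for a field `V` vanishing off the gapped split `I ∪ O` (outside modes `|k|² ≥ K2`), any `ν ≥ 0` and
any force slice `g`,
`-2ν·Z_O + Π(I→O) + ε_in,O ≤ 2(σ_I − ν·K2)·E_O + √(2E_O)·(Σ_{k∈O}|ĝ(k)|²)^{1/2}`.
Along a Galerkin solution the left side IS `dE_O/dt` (`hasDerivAt_outsideEnergy_galerkin`): this is
the Obukhov / Palasek level inequality `ẋ_k ≤ (A_{k-1} − νN_k²)x_k + g_k` as an upper bound, with the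
pump replaced by the rigorous inside strain `σ_I = Σ_{p∈I}|p||û(p)|`. -/
theorem outsideBudget_le_gap (V : FourierVelocity) (I O : Finset (Fin 3 → ℤ))
    (hoff : ∀ q ∉ I ∪ O, V.coeff q = 0) (hgap : ∀ k ∈ O, ∀ p ∈ I, k - p ∉ I)
    {ν : ℝ} (hν : 0 ≤ ν) {K2 : ℝ} (hK : ∀ k ∈ O, K2 ≤ knormSq k) (g : (Fin 3 → ℤ) → Fin 3 → ℂ) :
    -(2 * ν) * truncEnstrophy V O + shellTransfer V O I + injectionRate V g O ≤
      2 * ((∑ p ∈ I, Real.sqrt (knormSq p) * Real.sqrt (2 * modalEnergy V p)) - ν * K2) *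
          truncEnergy V O +
        Real.sqrt (2 * truncEnergy V O) * Real.sqrt (∑ k ∈ O, ∑ j, Complex.normSq (g k j)) := by
  have hZ := mul_truncEnergy_le_truncEnstrophy V O hK
  have hPi := (le_abs_self _).trans (abs_shellTransfer_le_gap V I O hoff hgap)
  have hε := (le_abs_self _).trans (abs_injectionRate_le V g O)
  nlinarith [hZ, hPi, hε, hν]

/-- **No growth across a gap while the inside strain is subcritical** (unforced): if
`σ_I(t) ≤ ν·K2` for all `t ∈ [0,T)`, the outside energy is non-increasing on `[0,T]`. In Palasek's
language: a gapped exact-coefficient level cannot be pumped while `A_{k-1} ≤ νN_k²`, whatever its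
current content. -/
theorem outsideEnergy_antitoneOn_of_gap {U : ℝ → FourierVelocity} {I O : Finset (Fin 3 → ℤ)}
    (hIO : Disjoint I O) {ν : ℝ} {c : ℝ → (Fin 3 → ℤ) → ℂ}
    (hU : IsGalerkinSolution U (I ∪ O) ν c fun _ _ _ => 0) (hsupp : IsSupportedOn U (I ∪ O))
    (hν : 0 ≤ ν) (hgap : ∀ k ∈ O, ∀ p ∈ I, k - p ∉ I) {K2 : ℝ} (hK : ∀ k ∈ O, K2 ≤ knormSq k)
    {T : ℝ} (hstrain : ∀ t ∈ Ico 0 T,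
      ∑ p ∈ I, Real.sqrt (knormSq p) * Real.sqrt (2 * modalEnergy (U t) p) ≤ ν * K2) :
    AntitoneOn (fun t => truncEnergy (U t) O) (Icc 0 T) := by
  have hder := fun s => hasDerivAt_outsideEnergy_galerkin hIO hU s
  refine antitoneOn_of_deriv_nonpos (convex_Icc 0 T)
    (fun s _ => (hder s).continuousAt.continuousWithinAt)
    (fun s _ => (hder s).differentiableAt.differentiableWithinAt) ?_
  intro s hs
  rw [interior_Icc] at hs
  rw [(hder s).deriv]
  have h := outsideBudget_le_gap (U s) I O (fun q hq => hsupp s q hq) hgap hν hK (fun _ _ => 0)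
  simp only [injectionRate_zero, add_zero, Complex.normSq_zero, Finset.sum_const_zero,
    Real.sqrt_zero, mul_zero] at h ⊢
  have hE : 0 ≤ truncEnergy (U s) O := Finset.sum_nonneg fun k _ => modalEnergy_nonneg (U s) k
  have hσ := hstrain s ⟨hs.1.le, hs.2⟩
  nlinarith [h, hE, hσ]

end Summit.NavierStokesRegularity.FluidComputer.GalerkinFluxCeiling
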